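import Literature.MathematicalPhysics.QuantumFieldTheory.Balaban1983to89.B12NodeKnitContinuousTransport
import Literature.MathematicalPhysics.QuantumFieldTheory.Balaban1983to89.Node00.Record10

/-!
# NODE N09 · [Balaban1987RG1] AT THE STAGE-10 RECORD `Node00.IsRecordOfRecord₁₀C` — the Theorem-3 member FROM [B11] THEOREM 1 AT THE RECORD'S OBJECTS AND THE
# RECORD'S OWN PROVISO, with NO displayed composition ∕ invariance clause: the ₁₀ twin of `B12NodeKnitRecord8` ∕ `B12NodeKnitRecord9`

T. Bałaban, *Renormalization group approach to lattice gauge field theories. I*, Commun. Math. Phys. **109** (1987) 249–301 [Balaban1987RG1] (= [I]);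
[Balaban1985Variational] (= [B11]) Thm 1 p. 279.  TRACK A (YM-PLAN §2b, node N09 of 28), seat `pub-ymgap-dag-n09-a` (prover, KNIT-BY-NAME; HUMAN RULING D-0062),
generation g4, MODULE 3.  THEOREMS ONLY, def-free, sorry-free, standard axioms.

THE STAGE-10 RECORD (`Node00.Record10`, node00-def-T; director LINE №45 (2), RIDER №6): the β of record and — CONSISTENTLY — the ACTION SIDE of the core are read
through the CONTINUOUS-VERSION transport `TcOfRecord` with def-χ's fixed-threshold `chiFixed7 θ.ν`: the construction's flow is `genFlow (betaOfRecord₁₀ θ) p.g₀`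
(`flow_datumOfRecord₁₀`, `rfl`) and its inductive-assumption clause is node00-def-B's transport-generic `IndAOfRecordT (TcOfRecord) (chiFixed7 θ.ν) …` at the
generated history `gOfRecord₁₀ θ p = genSeq (betaOfRecord₁₀ θ) p.g₀` and the record's objects (`indAss_stage10_iff`, `Iff.rfl`); its displayed provisos CARRY
`contT : θ.toStage8Params.HasContTransportAlong` (plan (c1)) — the (0.19) densities met along the β-layer have continuous transforms of record.

WHAT CHANGES FOR N09 AT ₁₀ (vs. `B12NodeKnitRecord8` §4∕§6, `B12NodeKnitRecord9`).  At Stages 8∕9 the member needed, besides (1.1) on the domains, the composition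
input `HCompT (TOfRecord) …` whose MIDDLE clauses (levels `1 ≤ j ≤ k − 2`, `K ≥ 3`) are point values of an RN-version transport — displayed, «unknowable».  At
Stage 10 those clauses are THEOREMS: `B12NodeKnitContinuousTransport.hCompT_TcOfRecord` (MODULE 2: continuous `IsRT` images of lift-invariant densities are gauge
invariant everywhere — MODULE 1 `B12ContinuousTransportInvariance` — and every (0.19) density is integrable), fed by the record's OWN `contT`.  So:

* §1 θ-EXPLICIT (world bound to `(datumOfRecord₁₀ θ h).C`): `indAss_stage10_of_hRestrict` (`IndAss k`, `k ≤ K`, from the flow recursion up to `k`, (1.1) at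
  level `k` on `domAltOfRecord`, `HRestrict`, intermediate uniqueness — NOTHING ELSE), `indAss_stage10_of_hCompT` (generic composition input, for comparison),
  `indAss_stage10_zero` (first step, window `θ.ν.ε₀ ≤ θ.εbg`), **`thm3Member_stage10_of_hRestrict`** (the Theorem-3 member `smallCouplings → smallFieldInductive`
  from (1.1) + `HRestrict` + intermediate uniqueness, via MODULE 2's `thm3Member_of_indATPlug_TcOfRecord` at (F) `flow_datumOfRecord₁₀`, (I) `indAss_stage10_iff`,
  proviso `h.contT`), `b12_main_stage10_of_leaf_of_hRestrict`, `b12_main_stage10_iff_leaf_of_hRestrict` (N09 ⇔ «b4 → … → b11 → b12»).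
* §2 AT `IsRecordOfRecord₁₀C F N D w`: **`thm3Member_at_record₁₀C_of_hRestrict`** (binders over the presenting parameters AND their provisos: (1.1) on the
  domains, `HRestrict`, intermediate uniqueness), **`b12_main_at_record₁₀C_iff_leaf`**, `b12_leaf_at_record₁₀C_iff` (the own leaf unfolded:
  `Lemma4Printed (θ.res.X P).F12 (θ.res.X P).c12` over the FREE residual B12 carriers — conjunct 1's pin NODE 00 still owes), **`b12_main_at_record₁₀C_of_leaf`**
  (N09 at every run of a Stage-10 record from the B12-group pin slot + [B11] Thm 1 at the record's objects — the `h09`-binder shape for N24's knit at ₁₀C).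
CENSUS OF N09 AT ₁₀ (kernel): member ⇐ (c) [B11] Thm 1 at the record's level domains ((1.1) existence + uniqueness on `domAltOfRecord`, `HRestrict`, uniqueness at
the averaged minimisers) — N07's content at the record — and the record's own provisos; (d) composition ∕ invariance clauses: NONE displayed (theorems);
conjunct 1 = the B12-group pin over the free `Residual₅.X` (unchanged).
HONEST FRAMING: count-neutral kernel bookkeeping; N09 NOT discharged (conjunct 1's pin and N07's inputs are binders; `IsRecordOfRecord₁₀C` not yet known
inhabited — K0); nothing of Bałaban's asserted; one finite four-torus programme at fixed ε — NOT ℝ⁴, NOT infinite volume, NOT OS axioms, NOT a mass gap, NOT Clay.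
-/

noncomputable section

namespace Literature.MathematicalPhysics.QuantumFieldTheory.Balaban1983to89.B12NodeKnitRecord10

open DagBinding Node00 T4Continuum
open FlowStep (HBeta prefixOf RGEqH)
open FlowStepRuns (genSeq genFlow)
open T4FlagMemory (extd)
open B12NodeKnitRecord8 (b12_main_of_leaf_of_thm3Member b12_main_iff_leaf_of_thm3Member uniqueUkOrbit_zero hCompT_zero)
open B12NodeKnitIndAPlug (thm3Member_of_indATPlug_of_hCompT)
open B12NodeKnitContinuousTransport (chiFixed7_extd_prefixOf indAOfRecordT_atRecord_TcOfRecord thm3Member_of_indATPlug_TcOfRecord)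

variable (F : T4Family) (N : ℕ) [NeZero N]

/-! ## §1. θ-explicit: a world bound to the Stage-10 construction `(datumOfRecord₁₀ θ h).C` -/

/-- **`IndAss k` AT THE STAGE-10 CONSTRUCTION from a generic composition input** (for comparison with Stages 8∕9): the flow recursion up to `k`, (1.1) at level `k`
on the domain and `HCompT (TcOfRecord) (chiFixed7 θ.ν) …` give node00-def-B's clause (`indAOfRecordT_atRecord`; χ-locality is `rfl` for the coupling-blind χ).
[cite: Balaban1987RG1, (1.1)–(1.3) p.260 and (0.22)–(0.23) p.256] -/
theorem indAss_stage10_of_hCompT (θ : Stage9Params F N) (h : θ.Provisos₁₀) (p : B12.RunParams) (k : ℕ)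
    (hflow : RGEqH k (betaOfRecord₁₀ F N θ) (gOfRecord₁₀ F N θ p))
    (h11 : ∀ V ∈ domAltOfRecord F N θ.ν p.K k, UkExists F N p.K k θ.εbg V ∧ UniqueUkOrbit F N p.K k θ.εbg V)
    (hcomp : HCompT F N (TcOfRecord F N) (chiFixed7 F N θ.ν) θ.εbg p.K (gOfRecord₁₀ F N θ p) k (domAltOfRecord F N θ.ν p.K k)) :
    ((datumOfRecord₁₀ F N θ h).C p).IndAss k :=
  (indAss_stage10_iff F N θ h p k).2
    (indAOfRecordT_atRecord F N (TcOfRecord F N) (chiFixed7 F N θ.ν) θ.εbg (betaOfRecord₁₀ F N θ) p k (domAltOfRecord F N θ.ν p.K k)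
      (chiFixed7_extd_prefixOf θ.ν p.K _ k) hflow h11 hcomp)

/-- **`IndAss k` AT THE STAGE-10 CONSTRUCTION FROM [B11] THM 1 AT THE RECORD'S OBJECTS ALONE** (`k ≤ K`): the flow recursion up to `k`, (1.1) at level `k` on
`domAltOfRecord`, `HRestrict` and (1.1)-uniqueness at the intermediate levels — the composition input is MODULE 2's theorem `hCompT_TcOfRecord` fed by the record's
own proviso `h.contT`.  NO composition, invariance or χ-locality hypothesis. [cite: Balaban1987RG1, (1.1)–(1.3) p.260, (0.22)–(0.23) p.256, p.263 and (2.16) p.269; Balaban1985Variational, Thm 1 (8)–(10) p.279] -/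
theorem indAss_stage10_of_hRestrict (θ : Stage9Params F N) (h : θ.Provisos₁₀) (p : B12.RunParams) (k : ℕ) (hk : k ≤ p.K)
    (hflow : RGEqH k (betaOfRecord₁₀ F N θ) (gOfRecord₁₀ F N θ p))
    (h11 : ∀ V ∈ domAltOfRecord F N θ.ν p.K k, UkExists F N p.K k θ.εbg V ∧ UniqueUkOrbit F N p.K k θ.εbg V)
    (hres : HRestrict F N θ.εbg p.K k (domAltOfRecord F N θ.ν p.K k))
    (huniq : ∀ V ∈ domAltOfRecord F N θ.ν p.K k, ∀ j < k,
      UniqueUkOrbit F N p.K (j + 1) θ.εbg (Averaging.iter (avOfRecord F N p.K) (j + 1) (Uk F N p.K k θ.εbg V))) :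
    ((datumOfRecord₁₀ F N θ h).C p).IndAss k :=
  (indAss_stage10_iff F N θ h p k).2
    (indAOfRecordT_atRecord_TcOfRecord θ.ν θ.εbg (betaOfRecord₁₀ F N θ) p k hk (domAltOfRecord F N θ.ν p.K k)
      (fun j hj => h.contT p.K (gOfRecord₁₀ F N θ p) j (hj.trans_le hk)) hflow h11 hres huniq)

/-- **THE FIRST STEP AT THE STAGE-10 CONSTRUCTION** modulo the numeric window `θ.ν.ε₀ ≤ θ.εbg` between the domain threshold of record and the regularity radius at level
`0` (as `B12NodeKnitRecord8.indAss_stage8_zero`): (1.1) at level `0` by `ukExists_zero_iff` ∕ `uniqueUkOrbit_zero`, (1.3) at `k = 0` with empty sums, `HCompT` vacuous.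
[cite: Balaban1987RG1, (0.17) p.255 and (1.1)–(1.3) p.260] -/
theorem indAss_stage10_zero (θ : Stage9Params F N) (h : θ.Provisos₁₀) (hε : θ.ν.ε₀ ≤ θ.εbg) (p : B12.RunParams) :
    ((datumOfRecord₁₀ F N θ h).C p).IndAss 0 := by
  refine indAss_stage10_of_hCompT F N θ h p 0 (fun j hj => absurd hj (Nat.not_lt_zero j)) (fun V hV => ⟨?_, uniqueUkOrbit_zero V⟩)
    (hCompT_zero _ _ _ _)
  rw [ukExists_zero_iff, mem_bgReg_iff]
  rw [mem_domAltOfRecord_iff] at hV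
  have heta : (F.P p.K).eta 0 = 1 := by simp [Params.eta]
  intro q
  calc dist1 (GaugeField.plaqHol V q) < θ.ν.ε₀ := hV q
    _ ≤ θ.εbg * (F.P p.K).eta 0 ^ 2 := by rw [heta]; simpa using hε

section Stage10

variable {F N}
variable (θ : Stage9Params F N) (h : θ.Provisos₁₀) {w : WorldP} (hC : w.C = (datumOfRecord₁₀ F N θ h).C) (P : B12.RunParams)

include hC in
/-- **THE THEOREM-3 MEMBER OF N09 AT `(w, P)` FOR A WORLD BOUND TO THE STAGE-10 CONSTRUCTION, FROM [B11] THM 1 AT THE RECORD'S OBJECTS ALONE**: (1.1) on the level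
domains `domAltOfRecord`, `HRestrict` ([B11] Thm 1 (8)–(10): the global minimiser restricts) and (1.1)-uniqueness at the intermediate levels give
`smallCouplings → smallFieldInductive` — MODULE 2's `thm3Member_of_indATPlug_TcOfRecord` at (F) `flow_datumOfRecord₁₀`, (I) `indAss_stage10_iff`, with the per-step
continuity proviso supplied by the record itself (`h.contT`).  Compare `B12NodeKnitRecord9.thm3Member_stage9_of_hRestrict`, which needed the orbit-point invariance of
`A_j ∘ Ū^j` as a fourth binder. [cite: Balaban1987RG1, Thm 3 p.264, (1.1)–(1.3) p.260, (0.21)–(0.23) p.256, p.263 and (2.16) p.269; Balaban1985Variational, Thm 1 (8)–(10) p.279] -/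
theorem thm3Member_stage10_of_hRestrict
    (h11 : ∀ k, k ≤ P.K → ∀ V ∈ domAltOfRecord F N θ.ν P.K k, UkExists F N P.K k θ.εbg V ∧ UniqueUkOrbit F N P.K k θ.εbg V)
    (hres : ∀ k, k ≤ P.K → HRestrict F N θ.εbg P.K k (domAltOfRecord F N θ.ν P.K k))
    (huniq : ∀ k, k ≤ P.K → ∀ V ∈ domAltOfRecord F N θ.ν P.K k, ∀ j < k,
      UniqueUkOrbit F N P.K (j + 1) θ.εbg (Averaging.iter (avOfRecord F N P.K) (j + 1) (Uk F N P.K k θ.εbg V))) :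
    (leavesP w P).smallCouplings → (leavesP w P).smallFieldInductive :=
  thm3Member_of_indATPlug_TcOfRecord θ.ν θ.εbg (betaOfRecord₁₀ F N θ) (fun k => domAltOfRecord F N θ.ν P.K k)
    (by rw [hC]; exact flow_datumOfRecord₁₀ F N θ h P) (fun k _ => by rw [hC]; exact indAss_stage10_iff F N θ h P k)
    (fun k hk => h.contT P.K (gOfRecord₁₀ F N θ P) k hk) h11 hres huniq

include hC in
/-- **The member at the Stage-10 construction from (1.1) on the domains and a generic composition input** (the Stage-8∕9 shape, for comparison — at ₁₀ the
input is a theorem, `B12NodeKnitContinuousTransport.hCompT_TcOfRecord`). [cite: Balaban1987RG1, Thm 3 p.264, (1.1)–(1.3) p.260 and (0.22)–(0.23) p.256] -/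
theorem thm3Member_stage10_of_hCompT
    (h11 : ∀ k, k ≤ P.K → ∀ V ∈ domAltOfRecord F N θ.ν P.K k, UkExists F N P.K k θ.εbg V ∧ UniqueUkOrbit F N P.K k θ.εbg V)
    (hcomp : ∀ k, k ≤ P.K → HCompT F N (TcOfRecord F N) (chiFixed7 F N θ.ν) θ.εbg P.K (gOfRecord₁₀ F N θ P) k (domAltOfRecord F N θ.ν P.K k)) :
    (leavesP w P).smallCouplings → (leavesP w P).smallFieldInductive :=
  thm3Member_of_indATPlug_of_hCompT (TcOfRecord F N) (chiFixed7 F N θ.ν) θ.εbg (betaOfRecord₁₀ F N θ) (fun k => domAltOfRecord F N θ.ν P.K k)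
    (by rw [hC]; exact flow_datumOfRecord₁₀ F N θ h P) (fun k _ => by rw [hC]; exact indAss_stage10_iff F N θ h P k)
    (fun k _ => chiFixed7_extd_prefixOf θ.ν P.K _ k) h11 hcomp

include hC in
/-- **N09 AT `(w, P)`, Stage-10 construction, from the own leaf and [B11] Thm 1 at the record's objects.** [cite: Balaban1987RG1, Lemma 4 (3.53) p.280, Thm 3 p.264 and (1.1)–(1.3) p.260; Balaban1985Variational, Thm 1 p.279] -/
theorem b12_main_stage10_of_leaf_of_hRestrict (h12 : (leavesP w P).b12)
    (h11 : ∀ k, k ≤ P.K → ∀ V ∈ domAltOfRecord F N θ.ν P.K k, UkExists F N P.K k θ.εbg V ∧ UniqueUkOrbit F N P.K k θ.εbg V)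
    (hres : ∀ k, k ≤ P.K → HRestrict F N θ.εbg P.K k (domAltOfRecord F N θ.ν P.K k))
    (huniq : ∀ k, k ≤ P.K → ∀ V ∈ domAltOfRecord F N θ.ν P.K k, ∀ j < k,
      UniqueUkOrbit F N P.K (j + 1) θ.εbg (Averaging.iter (avOfRecord F N P.K) (j + 1) (Uk F N P.K k θ.εbg V))) :
    Dag.B12_main (leavesP w P) :=
  b12_main_of_leaf_of_thm3Member h12 (thm3Member_stage10_of_hRestrict θ h hC P h11 hres huniq)

include hC in
/-- **N09 AT `(w, P)`, Stage-10 construction, IS «in-edges → its own leaf `b12`»** given [B11] Thm 1 at the record's objects. [cite: Balaban1987RG1, Lemma 4 (3.53) p.280 and Thm 3 p.264] -/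
theorem b12_main_stage10_iff_leaf_of_hRestrict
    (h11 : ∀ k, k ≤ P.K → ∀ V ∈ domAltOfRecord F N θ.ν P.K k, UkExists F N P.K k θ.εbg V ∧ UniqueUkOrbit F N P.K k θ.εbg V)
    (hres : ∀ k, k ≤ P.K → HRestrict F N θ.εbg P.K k (domAltOfRecord F N θ.ν P.K k))
    (huniq : ∀ k, k ≤ P.K → ∀ V ∈ domAltOfRecord F N θ.ν P.K k, ∀ j < k,
      UniqueUkOrbit F N P.K (j + 1) θ.εbg (Averaging.iter (avOfRecord F N P.K) (j + 1) (Uk F N P.K k θ.εbg V))) :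
    Dag.B12_main (leavesP w P) ↔
      ((leavesP w P).b4 → (leavesP w P).b5 → (leavesP w P).b6 → (leavesP w P).b7 → (leavesP w P).b8 → (leavesP w P).b9 →
        (leavesP w P).b10 → (leavesP w P).b11 → (leavesP w P).b12) :=
  b12_main_iff_leaf_of_thm3Member (thm3Member_stage10_of_hRestrict θ h hC P h11 hres huniq)

end Stage10

/-! ## §2. At the Stage-10 record predicate `IsRecordOfRecord₁₀C F N D w` (binders over the presenting parameters and their provisos) -/

section Record

variable {F N}
variable {D : FiniteEpsData F (SU N)} {w : WorldP}

/-- **THE THEOREM-3 MEMBER OF N09 AT EVERY RUN OF A STAGE-10 RECORD, FROM [B11] THM 1 AT THE RECORD'S OBJECTS** over the presenting parameters: (1.1) on the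
domains, `HRestrict`, intermediate uniqueness — no composition ∕ invariance binder (the record's `contT` feeds MODULE 2's theorem).
[cite: Balaban1987RG1, Thm 1 p.259, Thm 3 p.264, (1.1)–(1.3) p.260 and (2.16) p.269; Balaban1985Variational, Thm 1 (8)–(10) p.279] -/
theorem thm3Member_at_record₁₀C_of_hRestrict (hrec : IsRecordOfRecord₁₀C F N D w)
    (h11 : ∀ θ : Stage9Params F N, ∀ h : θ.Provisos₁₀, θ.Admissible → D = datumOfRecord₁₀ F N θ h → w.γ ≤ θ.γ →
      ∀ (p : B12.RunParams) (k : ℕ), k ≤ p.K →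
        ∀ V ∈ domAltOfRecord F N θ.ν p.K k, UkExists F N p.K k θ.εbg V ∧ UniqueUkOrbit F N p.K k θ.εbg V)
    (hres : ∀ θ : Stage9Params F N, ∀ h : θ.Provisos₁₀, θ.Admissible → D = datumOfRecord₁₀ F N θ h → w.γ ≤ θ.γ →
      ∀ (p : B12.RunParams) (k : ℕ), k ≤ p.K → HRestrict F N θ.εbg p.K k (domAltOfRecord F N θ.ν p.K k))
    (huniq : ∀ θ : Stage9Params F N, ∀ h : θ.Provisos₁₀, θ.Admissible → D = datumOfRecord₁₀ F N θ h → w.γ ≤ θ.γ →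
      ∀ (p : B12.RunParams) (k : ℕ), k ≤ p.K → ∀ V ∈ domAltOfRecord F N θ.ν p.K k, ∀ j < k,
        UniqueUkOrbit F N p.K (j + 1) θ.εbg (Averaging.iter (avOfRecord F N p.K) (j + 1) (Uk F N p.K k θ.εbg V)))
    (P : B12.RunParams) : (leavesP w P).smallCouplings → (leavesP w P).smallFieldInductive := by
  obtain ⟨θ, h, hθ, hD, hC, hγ, -, -⟩ := hrec
  have hC' : w.C = (datumOfRecord₁₀ F N θ h).C := by rw [hC, hD]
  exact thm3Member_stage10_of_hRestrict θ h hC' P (fun k hk => h11 θ h hθ hD hγ.2 P k hk) (fun k hk => hres θ h hθ hD hγ.2 P k hk)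
    (fun k hk => huniq θ h hθ hD hγ.2 P k hk)

/-- **N09 AT A STAGE-10 RECORD IS ITS OWN LEAF** (given [B11] Thm 1 at the record's objects over the presenting parameters): `Dag.B12_main (leavesP w P)` ↔ «`b4 → … →
b11 → b12`». [cite: Balaban1987RG1, Lemma 4 (3.53) p.280, Thm 1 p.259 and Thm 3 p.264] -/
theorem b12_main_at_record₁₀C_iff_leaf (hrec : IsRecordOfRecord₁₀C F N D w)
    (h11 : ∀ θ : Stage9Params F N, ∀ h : θ.Provisos₁₀, θ.Admissible → D = datumOfRecord₁₀ F N θ h → w.γ ≤ θ.γ →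
      ∀ (p : B12.RunParams) (k : ℕ), k ≤ p.K →
        ∀ V ∈ domAltOfRecord F N θ.ν p.K k, UkExists F N p.K k θ.εbg V ∧ UniqueUkOrbit F N p.K k θ.εbg V)
    (hres : ∀ θ : Stage9Params F N, ∀ h : θ.Provisos₁₀, θ.Admissible → D = datumOfRecord₁₀ F N θ h → w.γ ≤ θ.γ →
      ∀ (p : B12.RunParams) (k : ℕ), k ≤ p.K → HRestrict F N θ.εbg p.K k (domAltOfRecord F N θ.ν p.K k))
    (huniq : ∀ θ : Stage9Params F N, ∀ h : θ.Provisos₁₀, θ.Admissible → D = datumOfRecord₁₀ F N θ h → w.γ ≤ θ.γ →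
      ∀ (p : B12.RunParams) (k : ℕ), k ≤ p.K → ∀ V ∈ domAltOfRecord F N θ.ν p.K k, ∀ j < k,
        UniqueUkOrbit F N p.K (j + 1) θ.εbg (Averaging.iter (avOfRecord F N p.K) (j + 1) (Uk F N p.K k θ.εbg V)))
    (P : B12.RunParams) :
    Dag.B12_main (leavesP w P) ↔
      ((leavesP w P).b4 → (leavesP w P).b5 → (leavesP w P).b6 → (leavesP w P).b7 → (leavesP w P).b8 → (leavesP w P).b9 →
        (leavesP w P).b10 → (leavesP w P).b11 → (leavesP w P).b12) :=
  b12_main_iff_leaf_of_thm3Member (thm3Member_at_record₁₀C_of_hRestrict hrec h11 hres huniq P)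

/-- **THE OWN LEAF AT A STAGE-10 RECORD, UNFOLDED** over the presenting parameters: `(leavesP w P).b12 ↔ B12Sec2to5.Lemma4Printed (θ.res.X P).F12 (θ.res.X P).c12` —
Lemma 4 over the record's FREE run-indexed B12 carriers (the B12-group pin NODE 00 owes; the Stage-10 residual keeps `X` free). [cite: Balaban1987RG1, Lemma 4 (3.53) p.280 (bookkeeping)] -/
theorem b12_leaf_at_record₁₀C_iff (hrec : IsRecordOfRecord₁₀C F N D w) (P : B12.RunParams) :
    ∃ (θ : Stage9Params F N) (h : θ.Provisos₁₀), θ.Admissible ∧ D = datumOfRecord₁₀ F N θ h ∧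
      (∀ P', w.up P' = upOfRecord₅C F N (θ.toStage5₁₀ F N) P') ∧
        ((leavesP w P).b12 ↔ B12Sec2to5.Lemma4Printed (θ.res.X P).F12 (θ.res.X P).c12) := by
  obtain ⟨θ, h, hθ, hD, -, -, -, hup⟩ := hrec
  refine ⟨θ, h, hθ, hD, hup, ?_⟩
  show (w.up P).b12 ↔ _
  rw [hup P]
  exact Iff.rfl

/-- **N09 AT EVERY RUN OF A STAGE-10 RECORD from the B12-group pin slot + [B11] Thm 1 at the record's objects over the presenting parameters** — the `h09`-binder
shape for N24's knit at ₁₀C (cf. `B12NodeKnitRecord9.b12_main_at_record₉C_of_leaf`, whose `hcomp` binder is GONE here). [cite: Balaban1987RG1, Lemma 4 (3.53) p.280, Thm 1 p.259 and Thm 3 p.264; Balaban1985Variational, Thm 1 p.279] -/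
theorem b12_main_at_record₁₀C_of_leaf (hrec : IsRecordOfRecord₁₀C F N D w)
    (hb12 : ∀ θ : Stage9Params F N, ∀ h : θ.Provisos₁₀, θ.Admissible → D = datumOfRecord₁₀ F N θ h → w.γ ≤ θ.γ →
      (∀ P, w.up P = upOfRecord₅C F N (θ.toStage5₁₀ F N) P) → ∀ P, B12Sec2to5.Lemma4Printed (θ.res.X P).F12 (θ.res.X P).c12)
    (h11 : ∀ θ : Stage9Params F N, ∀ h : θ.Provisos₁₀, θ.Admissible → D = datumOfRecord₁₀ F N θ h → w.γ ≤ θ.γ →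
      ∀ (p : B12.RunParams) (k : ℕ), k ≤ p.K →
        ∀ V ∈ domAltOfRecord F N θ.ν p.K k, UkExists F N p.K k θ.εbg V ∧ UniqueUkOrbit F N p.K k θ.εbg V)
    (hres : ∀ θ : Stage9Params F N, ∀ h : θ.Provisos₁₀, θ.Admissible → D = datumOfRecord₁₀ F N θ h → w.γ ≤ θ.γ →
      ∀ (p : B12.RunParams) (k : ℕ), k ≤ p.K → HRestrict F N θ.εbg p.K k (domAltOfRecord F N θ.ν p.K k))
    (huniq : ∀ θ : Stage9Params F N, ∀ h : θ.Provisos₁₀, θ.Admissible → D = datumOfRecord₁₀ F N θ h → w.γ ≤ θ.γ →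
      ∀ (p : B12.RunParams) (k : ℕ), k ≤ p.K → ∀ V ∈ domAltOfRecord F N θ.ν p.K k, ∀ j < k,
        UniqueUkOrbit F N p.K (j + 1) θ.εbg (Averaging.iter (avOfRecord F N p.K) (j + 1) (Uk F N p.K k θ.εbg V)))
    (P : B12.RunParams) : Dag.B12_main (leavesP w P) := by
  obtain ⟨θ, h, hθ, hD, hC, hγ, -, hup⟩ := id hrec
  have h12 : (leavesP w P).b12 := by
    show (w.up P).b12
    rw [hup P]
    exact hb12 θ h hθ hD hγ.2 hup P
  exact b12_main_of_leaf_of_thm3Member h12 (thm3Member_at_record₁₀C_of_hRestrict hrec h11 hres huniq P)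

end Record

end Literature.MathematicalPhysics.QuantumFieldTheory.Balaban1983to89.B12NodeKnitRecord10

end
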